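import Literature.NumberTheory.EllipticCurves.HalfIntegralWeightFormsProofs
import HarnessLib

/-!
# Crux `PrintCFram.BottomClassIndexLawFiveLe` (stmt-BirchSwinnertonDyer-20372), line `eisenstein-resource-bdp-line` (registry v29 `stub_flipRungs.2`):
# THE 2-ADIC FLIPPED-CUSP RUNG, modular assembly piece (M1) — SQUARE-CLASS CUTS AT GENUINELY HALF-INTEGRAL WEIGHT
# (cell `bsd-print-cfram`, width seat `bsd-line-cfram-p1-w7` g9; THEOREMS ONLY, `--supports` 20372 `--as helper`; BSD is not proved by any of this)

HONEST FRAMING. Nothing here is a statement about BSD, elliptic curves or Bernoulli numbers; no registered stub is closed. This is the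
first piece of the MODULAR half `jmlTwo_six_of_facts : NF-A → NF-Q → (JMLTwo⁶)` of T6e (crux notes
`Lines/eisenstein-resource-bdp-line-w7g8-T6.md` §5; (JMLTwo⁶) = seat w6 g10's frozen interface, HOME/STATUS 2026-08-29T10:40:47Z): the
vehicle of the 2-adic rung is `V = classProj c (G|U_4) · θ` where `G` is the ODD-CONDITION cut of Cohen's `H_k` (indices `m₁ ∣ i`,
Legendre classes of `i/m₁` at the odd primes of `m`, `3 ∤ i/m₁`). The odd-translate flip identity (P1, `…FlipRungTwoFlipIdentity`) needs
`G|U_4` to be `Γ₀(N)`-AUTOMORPHIC WITH THE HALF-INTEGRAL FACTOR `autFactor (2k+1) N 1` at the matrices `γ_j` with `d_j = 8 + M′j`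
(NOT `≡ 1` modulo the period), so the `Γ₁`-type invariance of the integral-weight cuts used for the odd rung
(`…FlipRungVehicleInvariance` (G2), `Literature.….PeriodicTwist`) is not enough. This file proves the half-integral-weight statement:

**a translate average `T_b f(z) = Σ_{t mod Q} b(t) f(z + t/Q)` of `f ∈ M_{k/2}(N, χ)` (`4 ∣ N`, ANY `k`, ANY `Q ≥ 1`) whose weights are
SQUARE-CLASS INVARIANT (`b(d²t) = b(t)` for every unit `d` of `ℤ/Q`) lies in `M_{k/2}(N Q², χ)`, with `q`-expansion
`(Σ_t b(t) e(nt/Q)) · a(n)`** — Shimura 1973 §1 bookkeeping: `τ_{t/Q} γ = γ′ τ_{d²t/Q}` with `γ′ ∈ Γ₀(N)` (`Q² ∣ c`), and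
`χ(d′) j(γ′, z + d²t/Q)^k = χ(d) j(γ, z)^k` because `d′ = d − (c/Q²)·(Q d² t)` (`ε_{d′} = ε_d`, `(c/d′) = (c/d)` by
`shimuraSymbol_sq_mul_left` and the `d ↦ d ± c` periodicity `shimuraSymbol_add_self`, same square root `√(cz + d)`); the permutation
`t ↦ d² t` of `ℤ/Q` is absorbed by the square-class invariance of `b`. Consequently the cut of `f` along ANY `Q`-periodic index set
`S ⊆ ℕ` stable under multiplication by unit squares (`b = Q⁻¹·𝓕𝟙_S`) lies in `M_{k/2}(N Q², χ)` with coefficients `𝟙_S(n) a(n)` (§5).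

* §1 `exists_conjTranslate` — the matrix `γ′` and the identity `(t/Q) +ᵥ γ•z = γ′ • ((d²t/Q) +ᵥ z)` on `ℍ`;
* §2 `shimuraSymbol_add_mul_self`, `autFactor_conjTranslate` — `χ(d′) j(γ′, (d²t/Q) +ᵥ z)^k = χ(d) j(γ, z)^k`;
* §3 `apply_natCast_add_vadd` (1-periodicity in the translate) and **`sqClassAverage_smul`** — `T_b f (γ•z) = χ(d) j(γ,z)^k T_b f(z)` on `Γ₀(N Q²)`;
* §4 `hasSum_sqClassAverage`, `qCoeffs_sqClassAverage` — the `q`-expansion; §5 **`sqClassAverage_mem_halfIntModularForms`** (holomorphy from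
  the `q`-series, cusps by the affine transport `isBoundedAtImInfty_slashSq_comp`) and the cut version **`sqClassCut_mem_halfIntModularForms`** /
  `qCoeffs_sqClassCut` (Fourier inversion on `ℤ/Q`).

No definitions, no named facts, no `sorry`. beyond-print theorem: NO (Shimura 1973 §1 / Shimura 1971 Prop. 3.64 bookkeeping).
References: [Shimura1973HalfIntegral] §1 (the factor `j(γ, z)`, Prop. 1.3–1.5); [Shimura1971] Prop. 3.64; crux notes w7g8-T6 §5b–§5c.
-/

set_option autoImplicit false
-- summit-side namespace `Summit.BirchSwinnertonDyer.BirchSwinnertonDyer.…` (single-conjunct summit, D-0017 layout)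
set_option linter.dupNamespace false

noncomputable section

open UpperHalfPlane hiding I
open Complex CongruenceSubgroup
open scoped MatrixGroups NumberTheorySymbols Real
open Literature.NumberTheory.EllipticCurves.ModularForms

namespace Summit.BirchSwinnertonDyer.BirchSwinnertonDyer.Theorems.PrintCFram.FlipRung

/-! ## §1 Conjugating a translation by `t/Q` past `γ ∈ Γ₀(N Q²)` -/

/-- **The conjugate `γ′ = τ_{t/Q}·γ·τ_{−d²t/Q}`.** For `γ = (a b; c d) ∈ SL₂(ℤ)` with `c = Q²·c₁` and `t ∈ ℤ` there is `γ′ ∈ SL₂(ℤ)` with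
bottom row `(c, d − c₁·(Q d² t))`, top-left entry `a + Q c₁ t`, and `(t/Q) +ᵥ γ•z = γ′ • ((d²t/Q) +ᵥ z)` for all `z ∈ ℍ`
(`γ′ = (a + Qc₁t, b − Qc₁bdt − c₁d²t²; c, d − Qc₁d²t)`; the choice `t′ = d²t ≡ t·d/a (mod Q)` makes `τ_{t/Q}γτ_{−t′/Q}` integral).
[cite: Shimura1973HalfIntegral, §1 (proof of Prop. 1.3)] -/
theorem exists_conjTranslate (γ : SL(2, ℤ)) {Q : ℕ} {c₁ : ℤ} (hQ : Q ≠ 0) (hc : (γ 1 0 : ℤ) = (Q : ℤ) ^ 2 * c₁) (t : ℤ) :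
    ∃ γ' : SL(2, ℤ), (γ' 1 0 : ℤ) = γ 1 0 ∧ (γ' 1 1 : ℤ) = γ 1 1 - c₁ * (Q * (γ 1 1) ^ 2 * t) ∧
      (γ' 0 0 : ℤ) = γ 0 0 + Q * c₁ * t ∧
      ∀ z : ℍ, ((((t : ℝ) / (Q : ℝ) : ℝ) +ᵥ (γ • z) : ℍ)) =
        γ' • (((((((γ 1 1 : ℤ) ^ 2 * t : ℤ) : ℝ) / (Q : ℝ) : ℝ)) +ᵥ z : ℍ)) := by
  have hdet : (γ 0 0 : ℤ) * γ 1 1 - γ 0 1 * γ 1 0 = 1 := by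
    have := Matrix.det_fin_two (γ : Matrix (Fin 2) (Fin 2) ℤ)
    rw [γ.det_coe] at this
    exact this.symm
  set a : ℤ := γ 0 0 with ha
  set b : ℤ := γ 0 1 with hb
  set d : ℤ := γ 1 1 with hd
  rw [hc] at hdet
  let M : Matrix (Fin 2) (Fin 2) ℤ :=
    !![a + Q * c₁ * t, b - Q * c₁ * b * d * t - c₁ * d ^ 2 * t ^ 2; (Q : ℤ) ^ 2 * c₁, d - c₁ * (Q * d ^ 2 * t)]
  have hM : M.det = 1 := by
    rw [Matrix.det_fin_two_of]
    linear_combination (1 - (Q : ℤ) * c₁ * d * t) * hdet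
  refine ⟨⟨M, hM⟩, ?_, ?_, ?_, fun z => ?_⟩
  · show M 1 0 = γ 1 0
    rw [hc]; rfl
  · show M 1 1 = _
    rfl
  · show M 0 0 = _
    rfl
  · have hQC : (Q : ℂ) ≠ 0 := by exact_mod_cast hQ
    have hden : (Q : ℂ) ^ 2 * c₁ * (z : ℂ) + d ≠ 0 := by
      have h := intLinear_ne_zero (gcd_c_d_eq_one γ) z
      rw [hc] at h
      push_cast at h
      exact h
    have hdetC : (a : ℂ) * d - b * ((Q : ℂ) ^ 2 * c₁) = 1 := by exact_mod_cast hdet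
    have hden' : (Q : ℂ) ^ 2 * c₁ * ((d : ℂ) ^ 2 * t / Q + (z : ℂ)) + ((d : ℂ) - c₁ * (Q * d ^ 2 * t)) =
        (Q : ℂ) ^ 2 * c₁ * (z : ℂ) + d := by
      field_simp
      ring
    -- the identity of complex numbers behind `τ_{t/Q} γ = γ′ τ_{d²t/Q}`
    have key : ((t : ℂ) / (Q : ℂ)) + ((a : ℂ) * (z : ℂ) + b) / ((Q : ℂ) ^ 2 * c₁ * (z : ℂ) + d) =
        (((a : ℂ) + Q * c₁ * t) * ((d : ℂ) ^ 2 * t / Q + (z : ℂ)) + ((b : ℂ) - Q * c₁ * b * d * t - c₁ * d ^ 2 * t ^ 2)) /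
          ((Q : ℂ) ^ 2 * c₁ * ((d : ℂ) ^ 2 * t / Q + (z : ℂ)) + ((d : ℂ) - c₁ * (Q * d ^ 2 * t))) := by
      rw [hden', div_add_div _ _ hQC hden, div_eq_div_iff (mul_ne_zero hQC hden) hden]
      field_simp
      linear_combination (-(t : ℂ) * d) * hdetC
    have e00 : M 0 0 = a + Q * c₁ * t := rfl
    have e01 : M 0 1 = b - Q * c₁ * b * d * t - c₁ * d ^ 2 * t ^ 2 := rfl
    have e10 : M 1 0 = (Q : ℤ) ^ 2 * c₁ := rfl
    have e11 : M 1 1 = d - c₁ * (Q * d ^ 2 * t) := rfl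
    apply UpperHalfPlane.ext
    rw [coe_vadd, coe_specialLinearGroup_apply, coe_specialLinearGroup_apply, coe_vadd]
    simp only [hc, e00, e01, e10, e11, ← ha, ← hb, ← hd, eq_intCast, Complex.ofReal_div, Complex.ofReal_intCast,
      Complex.ofReal_natCast]
    push_cast at key ⊢
    exact key

/-! ## §2 The automorphy factor `χ(d) j(γ, z)^k` does not see the conjugation -/

/-- `(c/d)` is unchanged under `d ↦ d + c·s` when `4 ∣ c` (iterate `shimuraSymbol_add_self` / `shimuraSymbol_sub_self`). [folklore] -/
theorem shimuraSymbol_add_mul_self {c d : ℤ} (hc : 4 ∣ c) (hd : Odd d) (s : ℤ) :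
    shimuraSymbol c (d + c * s) = shimuraSymbol c d := by
  have hce : Even c := by obtain ⟨e, he⟩ := hc; exact ⟨2 * e, by omega⟩
  induction s using Int.induction_on with
  | zero => simp
  | succ n ih =>
    have hodd : Odd (d + c * n) := hd.add_even (hce.mul_right _)
    rw [show d + c * ((n : ℤ) + 1) = (d + c * n) + c by ring, shimuraSymbol_add_self hc hodd, ih]
  | pred n ih =>
    have hodd : Odd (d + c * (-(n : ℤ))) := hd.add_even (hce.mul_right _)
    rw [show d + c * (-(n : ℤ) - 1) = (d + c * (-(n : ℤ))) - c by ring, shimuraSymbol_sub_self hc hodd, ih]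

/-- **`χ(d′) j(γ′, (d²t/Q) +ᵥ z)^k = χ(d) j(γ, z)^k`** for the conjugate `γ′` of §1 when `N ∣ c₁ = c/Q²` (`4 ∣ N`): the character sees
`d′ ≡ d (mod N)`, `ε_{d′} = ε_d` (`d′ ≡ d (mod 4)`), `(c/d′) = (Q²c₁/d′) = (c₁/d′) = (c₁/d) = (c/d)` (`shimuraSymbol_sq_mul_left`, the
`c₁`-periodicity `shimuraSymbol_add_mul_self`), and `c·(z + d²t/Q) + d′ = cz + d`. This is the half-integral-weight input that the
integral-weight invariance files never needed. [cite: Shimura1973HalfIntegral, §1 (1.10), Prop. 1.3] -/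
theorem autFactor_conjTranslate {k N : ℕ} {χ : DirichletCharacter ℂ N} (hN : 4 ∣ N) (γ γ' : SL(2, ℤ)) {Q : ℕ} {c₁ t : ℤ}
    (hQ : Q ≠ 0) (hc : (γ 1 0 : ℤ) = (Q : ℤ) ^ 2 * c₁) (hNc : (N : ℤ) ∣ c₁)
    (h10 : (γ' 1 0 : ℤ) = γ 1 0) (h11 : (γ' 1 1 : ℤ) = γ 1 1 - c₁ * (Q * (γ 1 1) ^ 2 * t)) (z : ℍ) :
    autFactor k N χ γ' (((((((γ 1 1 : ℤ) ^ 2 * t : ℤ) : ℝ) / (Q : ℝ) : ℝ)) +ᵥ z : ℍ)) = autFactor k N χ γ z := by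
  set d : ℤ := γ 1 1 with hd
  have h4c₁ : (4 : ℤ) ∣ c₁ := dvd_trans (by exact_mod_cast hN) hNc
  have hγ4 : γ ∈ Gamma0 4 := by
    rw [Gamma0_mem, ZMod.intCast_zmod_eq_zero_iff_dvd, hc]
    exact_mod_cast dvd_mul_of_dvd_right h4c₁ _
  have hdodd : Odd d := odd_d_of_mem_Gamma0 hγ4
  have hQZ : (Q : ℤ) ≠ 0 := by exact_mod_cast hQ
  have hcop : IsCoprime ((Q : ℤ) ^ 2 * c₁) d := by
    have h := Int.isCoprime_iff_gcd_eq_one.mpr (gcd_c_d_eq_one γ)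
    rwa [hc] at h
  have hQd : IsCoprime (Q : ℤ) d := by
    have h2 : IsCoprime ((Q : ℤ) ^ 2) d := hcop.of_mul_left_left
    exact (IsCoprime.pow_left_iff (by norm_num : 0 < 2)).mp h2
  have hQd' : IsCoprime (Q : ℤ) (d - c₁ * (Q * d ^ 2 * t)) := by
    have : d - c₁ * (Q * d ^ 2 * t) = d + Q * (-(c₁ * d ^ 2 * t)) := by ring
    rw [this]
    exact hQd.add_mul_left_right _
  -- the four ingredients
  have hχ : (((d - c₁ * (Q * d ^ 2 * t) : ℤ)) : ZMod N) = ((d : ℤ) : ZMod N) := by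
    have h0 : ((c₁ : ℤ) : ZMod N) = 0 := by
      rw [ZMod.intCast_zmod_eq_zero_iff_dvd]; exact_mod_cast hNc
    push_cast
    rw [h0]
    ring
  have hε : thetaEps (d - c₁ * (Q * d ^ 2 * t)) = thetaEps d := by
    apply thetaEps_eq_of_emod_eq
    obtain ⟨e, he⟩ := (dvd_mul_of_dvd_left h4c₁ (Q * d ^ 2 * t) : (4 : ℤ) ∣ c₁ * (Q * d ^ 2 * t))
    rw [he]
    omega
  have hσ : shimuraSymbol ((Q : ℤ) ^ 2 * c₁) (d - c₁ * (Q * d ^ 2 * t)) = shimuraSymbol ((Q : ℤ) ^ 2 * c₁) d := by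
    rw [shimuraSymbol_sq_mul_left hQZ (Int.isCoprime_iff_gcd_eq_one.mp hQd'),
      shimuraSymbol_sq_mul_left hQZ (Int.isCoprime_iff_gcd_eq_one.mp hQd),
      show d - c₁ * (Q * d ^ 2 * t) = d + c₁ * (-(Q * d ^ 2 * t)) by ring, shimuraSymbol_add_mul_self h4c₁ hdodd]
  have hQC : (Q : ℂ) ≠ 0 := by exact_mod_cast hQ
  have hsq : ((((Q : ℤ) ^ 2 * c₁ : ℤ)) : ℂ) * ((((((((d ^ 2 * t : ℤ)) : ℝ) / (Q : ℝ) : ℝ)) +ᵥ z : ℍ)) : ℂ) +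
        ((d - c₁ * (Q * d ^ 2 * t) : ℤ) : ℂ) = ((((Q : ℤ) ^ 2 * c₁ : ℤ)) : ℂ) * (z : ℂ) + (d : ℂ) := by
    rw [coe_vadd]
    push_cast
    field_simp
    ring
  unfold autFactor thetaFactor
  rw [h10, h11, hc, hχ, hε, hσ, hsq]

/-! ## §3 Automorphy of a square-class translate average on `Γ₀(N Q²)` -/

/-- `1`-periodicity read on the translates: `f((n + x) +ᵥ z) = f(x +ᵥ z)` for `n ∈ ℕ` when `f` is automorphic on `Γ₀(N)`
(`Tⁿ ∈ Γ₀(N)`, `χ(1) j(Tⁿ, z)^k = 1`). [folklore] -/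
theorem apply_natCast_add_vadd {k N : ℕ} {χ : DirichletCharacter ℂ N} {f : ℍ → ℂ}
    (hf : ∀ γ ∈ Gamma0 N, ∀ z : ℍ, f (γ • z) = autFactor k N χ γ z * f z) (x : ℝ) (n : ℕ) (z : ℍ) :
    f ((((n : ℝ) + x : ℝ)) +ᵥ z) = f ((x +ᵥ z : ℍ)) := by
  have hT : ModularGroup.T ^ (n : ℤ) ∈ Gamma0 N := by
    rw [Gamma0_mem, ModularGroup.coe_T_zpow]
    simp
  have h := hf _ hT (x +ᵥ z)
  rw [autFactor_T_zpow, one_mul, UpperHalfPlane.modular_T_zpow_smul, vadd_vadd, Int.cast_natCast] at h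
  exact h

/-- **AUTOMORPHY OF A SQUARE-CLASS TRANSLATE AVERAGE.** Let `f` satisfy `f(γz) = χ(d) j(γ,z)^k f(z)` on `Γ₀(N)` (`4 ∣ N`; a member of
`M_{k/2}(N, χ)` by `apply_smul_eq_of_mem`, or `G|U_4 = heckeFun k χ 2 G` by `heckeFun_smul`), `Q ≥ 1`, and let the weights
`b : ℤ/Q → ℂ` be SQUARE-CLASS INVARIANT: `b(u² t) = b(t)` for every unit `u`. Then `T_b f(z) = Σ_{t mod Q} b(t) f(z + t/Q)` satisfies
`T_b f(γ z) = χ(d) j(γ, z)^k · T_b f(z)` for every `γ ∈ SL₂(ℤ)` with `N Q² ∣ c` (§1–§2: each translate picks up the factor of `γ` and moves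
to the translate `d² t`; the permutation `t ↦ d² t` is absorbed by `b`). [cite: Shimura1973HalfIntegral, §1, Prop. 1.3–1.5] -/
theorem sqClassAverage_smul {k N : ℕ} {χ : DirichletCharacter ℂ N} (hN : 4 ∣ N) {Q : ℕ} [NeZero Q] {f : ℍ → ℂ}
    (hf : ∀ γ ∈ Gamma0 N, ∀ z : ℍ, f (γ • z) = autFactor k N χ γ z * f z)
    (b : ZMod Q → ℂ) (hb : ∀ u t : ZMod Q, IsUnit u → b (u ^ 2 * t) = b t)
    {γ : SL(2, ℤ)} (hγ : ((N * Q ^ 2 : ℕ) : ℤ) ∣ γ 1 0) (z : ℍ) :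
    (∑ t : ZMod Q, b t * f ((((t.val : ℝ) / (Q : ℝ) : ℝ)) +ᵥ γ • z)) =
      autFactor k N χ γ z * ∑ t : ZMod Q, b t * f ((((t.val : ℝ) / (Q : ℝ) : ℝ)) +ᵥ z) := by
  obtain ⟨c₀, hc₀⟩ := hγ
  set d : ℤ := γ 1 1 with hd
  have hQ : Q ≠ 0 := NeZero.ne Q
  have hQR : (Q : ℝ) ≠ 0 := by exact_mod_cast hQ
  have hc : (γ 1 0 : ℤ) = (Q : ℤ) ^ 2 * (N * c₀) := by rw [hc₀]; push_cast; ring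
  have hNc : (N : ℤ) ∣ (N : ℤ) * c₀ := dvd_mul_right _ _
  -- `d` is a unit modulo `Q`
  have hQd : IsCoprime (Q : ℤ) d := by
    have h := Int.isCoprime_iff_gcd_eq_one.mpr (gcd_c_d_eq_one γ)
    rw [hc] at h
    exact (IsCoprime.pow_left_iff (by norm_num : 0 < 2)).mp h.of_mul_left_left
  have hu : IsUnit ((d : ZMod Q) ^ 2) := (isUnit_intCast_of_isCoprime hQd.symm).pow 2
  -- the non-negative integer `d²` as a natural number
  set D : ℕ := (d ^ 2).toNat with hD
  have hDZ : (D : ℤ) = d ^ 2 := Int.toNat_of_nonneg (sq_nonneg d)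
  -- Step 1: each translate transforms with the factor of `γ` and lands on the translate `d² t`
  have step : ∀ t : ZMod Q, f ((((t.val : ℝ) / (Q : ℝ) : ℝ)) +ᵥ γ • z) =
      autFactor k N χ γ z * f (((((D * t.val : ℕ) : ℝ) / (Q : ℝ) : ℝ)) +ᵥ z) := by
    intro t
    obtain ⟨γ', h10, h11, -, hsm⟩ := exists_conjTranslate γ hQ hc (t.val : ℤ)
    have hγ'N : γ' ∈ Gamma0 N := by
      rw [Gamma0_mem, ZMod.intCast_zmod_eq_zero_iff_dvd, h10, hc]
      exact Dvd.intro ((Q : ℤ) ^ 2 * c₀) (by ring)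
    have h1 := hsm z
    rw [Int.cast_natCast] at h1
    rw [h1, hf γ' hγ'N, autFactor_conjTranslate hN γ γ' hQ hc hNc h10 h11]
    have hDR : ((D : ℕ) : ℝ) = ((γ 1 1 : ℤ) : ℝ) ^ 2 := by
      have h := hDZ
      rw [hd] at h
      exact_mod_cast h
    congr 3
    push_cast
    rw [hDR]
  -- Step 2: `d² t ↦ (d² t mod Q)` by `1`-periodicity, then reindex by the unit `d²`
  have step2 : ∀ t : ZMod Q, f (((((D * t.val : ℕ) : ℝ) / (Q : ℝ) : ℝ)) +ᵥ z) =
      f ((((((d : ZMod Q) ^ 2 * t).val : ℝ) / (Q : ℝ) : ℝ)) +ᵥ z) := by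
    intro t
    have hdiv := Nat.div_add_mod (D * t.val) Q
    have hval : ((d : ZMod Q) ^ 2 * t).val = (D * t.val) % Q := by
      rw [← ZMod.val_natCast]
      congr 1
      push_cast
      rw [ZMod.natCast_zmod_val, show ((D : ℕ) : ZMod Q) = ((D : ℤ) : ZMod Q) from (Int.cast_natCast D).symm, hDZ]
      push_cast
      ring
    rw [hval]
    have hx : (((D * t.val : ℕ) : ℝ) / (Q : ℝ)) = (((D * t.val) / Q : ℕ) : ℝ) + (((D * t.val) % Q : ℕ) : ℝ) / (Q : ℝ) := by
      conv_lhs => rw [← hdiv]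
      push_cast
      field_simp
    rw [hx, apply_natCast_add_vadd hf]
  have step3 : ∀ t : ZMod Q, b t * f ((((t.val : ℝ) / (Q : ℝ) : ℝ)) +ᵥ γ • z) =
      autFactor k N χ γ z * (b t * f ((((((d : ZMod Q) ^ 2 * t).val : ℝ) / (Q : ℝ) : ℝ)) +ᵥ z)) := by
    intro t
    rw [step, step2]
    ring
  simp_rw [step3]
  rw [← Finset.mul_sum]
  congr 1
  calc ∑ t : ZMod Q, b t * f ((((((d : ZMod Q) ^ 2 * t).val : ℝ) / (Q : ℝ) : ℝ)) +ᵥ z)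
      = ∑ t : ZMod Q, b ((d : ZMod Q) ^ 2 * t) * f ((((((d : ZMod Q) ^ 2 * t).val : ℝ) / (Q : ℝ) : ℝ)) +ᵥ z) := by
        refine Finset.sum_congr rfl (fun t _ => ?_)
        rw [hb _ t (isUnit_intCast_of_isCoprime hQd.symm)]
    _ = ∑ t : ZMod Q, b t * f ((((t.val : ℝ) / (Q : ℝ) : ℝ)) +ᵥ z) := by
        refine Fintype.sum_bijective (fun t : ZMod Q => (d : ZMod Q) ^ 2 * t) ?_ _ _ (fun t => rfl)
        exact Finite.injective_iff_bijective.mp hu.mul_right_injective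

/-! ## §4 The `q`-expansion of a translate average -/

/-- The translate `z + t/Q` is the affine point `(Qz + t)/Q` (for the cusp transport `isBoundedAtImInfty_slashSq_comp`). [folklore] -/
theorem coe_val_div_vadd_affine {Q : ℕ} [NeZero Q] (t : ZMod Q) (z : ℍ) :
    (((((((t.val : ℝ) / (Q : ℝ) : ℝ)) +ᵥ z)) : ℍ) : ℂ) = (((Q : ℤ) : ℂ) * z + ((t.val : ℤ) : ℂ)) / ((Q : ℤ) : ℂ) := by
  have hQ : (Q : ℂ) ≠ 0 := by exact_mod_cast NeZero.ne Q
  rw [coe_vadd]; push_cast; field_simp; ring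

/-- **THE `q`-EXPANSION OF A TRANSLATE AVERAGE** (any weights): if `f(τ) = Σ a(n) e(nτ)` on `ℍ` then
`Σ_{t mod Q} b(t) f(z + t/Q) = Σ_n (Σ_t b(t) ψ_Q(t·n)) a(n) e(nz)` (`ψ_Q` the standard additive character of `ℤ/Q`). [folklore] -/
theorem hasSum_translateAverage {Q : ℕ} [NeZero Q] {f : ℍ → ℂ} {a : ℕ → ℂ}
    (hf : ∀ τ : ℍ, HasSum (fun n ↦ a n * Function.Periodic.qParam 1 (τ : ℂ) ^ n) (f τ)) (b : ZMod Q → ℂ) (z : ℍ) :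
    HasSum (fun n : ℕ ↦ (∑ t : ZMod Q, b t * ZMod.stdAddChar (t * (n : ZMod Q))) * a n * Function.Periodic.qParam 1 (z : ℂ) ^ n)
      (∑ t : ZMod Q, b t * f (((((t.val : ℝ) / (Q : ℝ) : ℝ)) +ᵥ z : ℍ))) := by
  have hQ : (Q : ℂ) ≠ 0 := by exact_mod_cast NeZero.ne Q
  have h1 : HasSum (fun n : ℕ ↦ ∑ t : ZMod Q, b t *
      (a n * Function.Periodic.qParam 1 ((((((t.val : ℝ) / (Q : ℝ) : ℝ)) +ᵥ z : ℍ)) : ℂ) ^ n))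
      (∑ t : ZMod Q, b t * f (((((t.val : ℝ) / (Q : ℝ) : ℝ)) +ᵥ z : ℍ))) :=
    hasSum_sum fun t _ ↦ (hf _).mul_left _
  convert h1 using 1
  funext n
  have hq : ∀ t : ZMod Q, Function.Periodic.qParam 1 ((((((t.val : ℝ) / (Q : ℝ) : ℝ)) +ᵥ z : ℍ)) : ℂ) ^ n =
      Function.Periodic.qParam 1 (z : ℂ) ^ n * ZMod.stdAddChar (t * (n : ZMod Q)) := by
    intro t
    rw [qParam_one_pow, qParam_one_pow, coe_vadd, show (t * (n : ZMod Q)) = ((n * t.val : ℕ) : ZMod Q) by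
        push_cast; rw [ZMod.natCast_zmod_val, mul_comm], ← cexp_natCast_div Q (n * t.val), ← Complex.exp_add]
    congr 1
    push_cast
    field_simp
    ring
  simp_rw [hq]
  rw [Finset.sum_mul, Finset.sum_mul]
  exact Finset.sum_congr rfl fun t _ ↦ by ring

/-- **`qCoeffs (T_b f) n = (Σ_t b(t) ψ_Q(t·n)) · qCoeffs f n`** for `f ∈ M_{k/2}(N, χ)`. [folklore] -/
theorem qCoeffs_translateAverage {k N : ℕ} {χ : DirichletCharacter ℂ N} {Q : ℕ} [NeZero Q] {f : ℍ → ℂ}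
    (hf : f ∈ halfIntModularForms k N χ) (b : ZMod Q → ℂ) (n : ℕ) :
    qCoeffs (fun z : ℍ ↦ ∑ t : ZMod Q, b t * f (((((t.val : ℝ) / (Q : ℝ) : ℝ)) +ᵥ z : ℍ))) n =
      (∑ t : ZMod Q, b t * ZMod.stdAddChar (t * (n : ZMod Q))) * qCoeffs f n :=
  congrFun (qCoeffs_eq_of_hasSum (fun τ ↦ hasSum_translateAverage (hasSum_qCoeffs hf) b τ)) n

/-! ## §5 Membership: `T_b f ∈ M_{k/2}(N Q², χ)` for square-class invariant weights -/

/-- `χ↑(d) j(γ,z)^k = χ(d) j(γ,z)^k` on `Γ₀(N′)`, `N ∣ N′` (the factor does not see the change of level). [folklore] -/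
theorem autFactor_changeLevel {k N N' : ℕ} (h : N ∣ N') (χ : DirichletCharacter ℂ N) {γ : SL(2, ℤ)} (hγ : γ ∈ Gamma0 N') (z : ℍ) :
    autFactor k N' (DirichletCharacter.changeLevel h χ) γ z = autFactor k N χ γ z := by
  unfold autFactor
  congr 1
  obtain ⟨u, hu⟩ := isUnit_d_of_mem_Gamma0 hγ
  rw [← hu, DirichletCharacter.changeLevel_eq_cast_of_dvd χ h u, hu, ZMod.cast_intCast h]

/-- **SQUARE-CLASS TRANSLATE AVERAGES PRESERVE `M_{k/2}`**: for `f ∈ M_{k/2}(N, χ)` (`4 ∣ N`, any `k`), `Q ≥ 1` and square-class invariant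
weights `b` (`b(u²t) = b(t)` for units `u` of `ℤ/Q`), `T_b f = Σ_t b(t) f(· + t/Q) ∈ M_{k/2}(N Q², χ)`: holomorphic (a convergent `q`-series, §4),
theta-automorphic (§3 + `autFactor_changeLevel`), bounded at every cusp (each translate is `f ∘ ((Qz + t)/Q)`, `isBoundedAtImInfty_slashSq_comp`).
For `k` odd this is the genuinely half-integral-weight statement the odd rung never needed. [cite: Shimura1973HalfIntegral, §1, Prop. 1.3–1.5] -/
theorem sqClassAverage_mem_halfIntModularForms {k N : ℕ} {χ : DirichletCharacter ℂ N} (hN : 4 ∣ N) {Q : ℕ} [NeZero Q]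
    {f : ℍ → ℂ} (hf : f ∈ halfIntModularForms k N χ) (b : ZMod Q → ℂ) (hb : ∀ u t : ZMod Q, IsUnit u → b (u ^ 2 * t) = b t) :
    (fun z : ℍ ↦ ∑ t : ZMod Q, b t * f (((((t.val : ℝ) / (Q : ℝ) : ℝ)) +ᵥ z : ℍ))) ∈
      halfIntModularForms k (N * Q ^ 2) (DirichletCharacter.changeLevel (dvd_mul_right N (Q ^ 2)) χ) := by
  have hN' : 4 ∣ N * Q ^ 2 := dvd_mul_of_dvd_left hN _
  refine ⟨mdifferentiable_of_hasSum (fun τ ↦ hasSum_translateAverage (hasSum_qCoeffs hf) b τ), ?_, fun g ↦ ?_⟩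
  · refine isThetaAutomorphic_of_apply_smul_eq hN' (fun γ hγ z ↦ ?_)
    have hγ' : ((N * Q ^ 2 : ℕ) : ℤ) ∣ γ 1 0 := by
      rw [Gamma0_mem, ZMod.intCast_zmod_eq_zero_iff_dvd] at hγ
      exact hγ
    rw [autFactor_changeLevel _ χ hγ z]
    exact sqClassAverage_smul hN (fun γ hγ z ↦ apply_smul_eq_of_mem hN hf hγ z) b hb hγ' z
  · have hT : (fun z : ℍ ↦ ∑ t : ZMod Q, b t * f (((((t.val : ℝ) / (Q : ℝ) : ℝ)) +ᵥ z : ℍ))) =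
        ∑ t : ZMod Q, (b t) • (f ∘ fun z : ℍ ↦ (((((t.val : ℝ) / (Q : ℝ) : ℝ)) +ᵥ z : ℍ))) := by
      funext z
      simp only [Finset.sum_apply, Pi.smul_apply, Function.comp_apply, smul_eq_mul]
    rw [hT]
    have hQ : (0 : ℤ) < Q := by exact_mod_cast Nat.pos_of_ne_zero (NeZero.ne Q)
    exact isBoundedAtImInfty_slashSq_sum _ _ g fun t _ ↦ isBoundedAtImInfty_slashSq_smul _
      (isBoundedAtImInfty_slashSq_comp hQ hQ (coe_val_div_vadd_affine t) hf.2.2 g)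

/-- The coefficients of the member: `qCoeffs (T_b f) n = (Σ_t b(t) ψ_Q(t n))·qCoeffs f n` (restated next to the membership for consumers). [folklore] -/
theorem qCoeffs_sqClassAverage {k N : ℕ} {χ : DirichletCharacter ℂ N} {Q : ℕ} [NeZero Q] {f : ℍ → ℂ}
    (hf : f ∈ halfIntModularForms k N χ) (b : ZMod Q → ℂ) :
    qCoeffs (fun z : ℍ ↦ ∑ t : ZMod Q, b t * f (((((t.val : ℝ) / (Q : ℝ) : ℝ)) +ᵥ z : ℍ))) =
      fun n : ℕ ↦ (∑ t : ZMod Q, b t * ZMod.stdAddChar (t * (n : ZMod Q))) * qCoeffs f n :=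
  qCoeffs_eq_of_hasSum (fun τ ↦ hasSum_translateAverage (hasSum_qCoeffs hf) b τ)

end Summit.BirchSwinnertonDyer.BirchSwinnertonDyer.Theorems.PrintCFram.FlipRung

end
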